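import Mathlib.RingTheory.Ideal.Quotient.Operations
import Mathlib.RingTheory.LocalRing.MaximalIdeal.Basic
import Mathlib.RingTheory.LocalRing.ResidueField.Basic
import Mathlib.Algebra.Algebra.Pi
import HarnessLib

/-!
# [StacksProject Tag 00DT; Tag 04GG] Sections of a finite algebra over a LOCAL ring: distinct closed points ⇒ pairwise comaximal kernels ⇒
# the evaluation map `B → R^ι` is SURJECTIVE with kernel `⨅ ker sᵢ` (Chinese remainder)

Topic `RingTheory/Ideal`; namespace `Literature.RingTheory.Ideal`.  THEOREMS ONLY (no definition, no instance, no notation, no named fact, no `sorry`); Mathlib-only.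
Cell `pub/hodgecm-mathlib` (D-0151), programme P6 «MOD», sub-line `Cruxes/HLiu418/Lines/F0_P6b_ConnectedEtale.lean` ED. 1, stub `stub_b4_etaleClosureOfGenericSubgroup`
strategy σ2 «SECTIONS FIRST» (desk F0P6b-plan (g0) deal 13:42:14Z; hand B-p12 (g30), census `F0/P6/B-p12/CENSUS-P6b-b4-EtaleClosure-sigma2.B-p12g30.md`): brick (F1′).
HONEST LABEL: HC_CM is proved only modulo the printed citations (hLiu418, h413) until rung 0 closes; this file is count-neutral commutative algebra.

THE MATHEMATICS.  `R` local, `B` an `R`-algebra, `s : B →ₐ[R] R` a SECTION (an `R`-algebra map to the base; the `R`-points of `Spec B`).  Such an `s` is surjective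
(`s(algebraMap r) = r`), so `B ⧸ ker s ≅ R` is local: the ONLY maximal ideal of `B` above `ker s` is the CLOSED POINT `𝔫_s := s⁻¹(𝔪_R)` (§1
`eq_comap_maximalIdeal_of_ker_le`).  Hence two sections with DISTINCT closed points have COMAXIMAL kernels (§2 `isCoprime_ker_of_comap_maximalIdeal_ne`:
a maximal ideal above `ker s₁ + ker s₂` would be both closed points), and for a finite family `s : ι → (B →ₐ[R] R)` with pairwise distinct closed
points the Chinese remainder theorem (Mathlib `Ideal.quotientInfToPiQuotient_surj`) makes the evaluation map `B → R^ι`, `b ↦ (sᵢ b)ᵢ`, SURJECTIVE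
with kernel `⨅ᵢ ker sᵢ` (§3 `surjective_pi_of_pairwise_comap_maximalIdeal_ne`, `ker_pi_eq_iInf`): `B ⧸ ⨅ ker sᵢ ≅ R^ι` is free of rank `|ι|` and
a product of copies of the base — the coordinate ring of the CONSTANT finite étale subscheme through the sections ([StacksProject Tag 04GG] for
finite algebras over henselian local rings; used for the étale closure of a finite subgroup of sections meeting the unit component trivially).

## References
* [StacksProject] The Stacks Project: Tag 00DT (Chinese remainder for pairwise comaximal ideals), Tag 04GG (finite algebras over henselian local rings).
* [Tate1997FiniteFlatGroupSchemes] J. Tate, *Finite flat group schemes* (1997): (3.7) (connected–étale sequence; sections and the étale part).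
-/

set_option autoImplicit false

namespace Literature.RingTheory.Ideal

open IsLocalRing

/-! ## §1 A section of an algebra over a local ring: surjective, one closed point above its kernel -/

section Section

variable {R : Type*} [CommRing R] {B : Type*} [CommRing B] [Algebra R B]

/-- **A SECTION IS SURJECTIVE**: an `R`-algebra map `s : B →ₐ[R] R` hits every `r` (`s (algebraMap R B r) = r`). [cite: StacksProject, Tag 00DT] -/
theorem algHom_base_surjective (s : B →ₐ[R] R) : Function.Surjective s :=
  fun r => ⟨algebraMap R B r, s.commutes r⟩

variable [IsLocalRing R]

/-- **THE CLOSED POINT OF A SECTION IS THE ONLY MAXIMAL IDEAL ABOVE ITS KERNEL**: for `R` local and a section `s : B →ₐ[R] R`, every maximal ideal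
`𝔪 ⊇ ker s` equals `s⁻¹(𝔪_R)` (`B ⧸ ker s ≅ R` is local). [cite: StacksProject, Tag 04GG] -/
theorem eq_comap_maximalIdeal_of_ker_le (s : B →ₐ[R] R) {𝔪 : _root_.Ideal B} (h𝔪 : 𝔪.IsMaximal) (hle : RingHom.ker s ≤ 𝔪) :
    𝔪 = (maximalIdeal R).comap s := by
  have hsurj := algHom_base_surjective s
  -- `s(𝔪)` is a proper ideal of `R`: else `𝔪 = 𝔪 ⊔ ker s = s⁻¹(s(𝔪)) = ⊤`
  have hmap : 𝔪.map s ≠ ⊤ := by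
    intro htop
    have h := _root_.Ideal.comap_map_of_surjective s hsurj 𝔪
    have hker : _root_.Ideal.comap s ⊥ ≤ 𝔪 := by rw [← RingHom.ker_eq_comap_bot]; exact hle
    rw [sup_eq_left.2 hker, htop, _root_.Ideal.comap_top] at h
    exact h𝔪.ne_top h.symm
  have h1 : 𝔪 ≤ (maximalIdeal R).comap s := _root_.Ideal.map_le_iff_le_comap.1 (le_maximalIdeal hmap)
  exact h𝔪.eq_of_le (_root_.Ideal.comap_ne_top _ (maximalIdeal.isMaximal R).ne_top) h1

/-! ## §2 Distinct closed points ⇒ comaximal kernels -/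

/-- **DISTINCT CLOSED POINTS ⇒ COMAXIMAL KERNELS**: sections `s₁ s₂ : B →ₐ[R] R` (`R` local) with `s₁⁻¹(𝔪_R) ≠ s₂⁻¹(𝔪_R)` have `ker s₁ + ker s₂ = B`.
[cite: StacksProject, Tag 00DT] [cite: StacksProject, Tag 04GG] -/
theorem isCoprime_ker_of_comap_maximalIdeal_ne {s₁ s₂ : B →ₐ[R] R} (h : (maximalIdeal R).comap s₁ ≠ (maximalIdeal R).comap s₂) :
    IsCoprime (RingHom.ker s₁) (RingHom.ker s₂) := by
  rw [_root_.Ideal.isCoprime_iff_sup_eq]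
  by_contra hne
  obtain ⟨𝔪, h𝔪, hle⟩ := _root_.Ideal.exists_le_maximal _ hne
  exact h ((eq_comap_maximalIdeal_of_ker_le s₁ h𝔪 (le_sup_left.trans hle)).symm.trans
    (eq_comap_maximalIdeal_of_ker_le s₂ h𝔪 (le_sup_right.trans hle)))

end Section

/-! ## §3 The evaluation map of a finite family of sections with distinct closed points (Chinese remainder) -/

section Family

variable {R : Type*} [CommRing R] [IsLocalRing R] {B : Type*} [CommRing B] [Algebra R B] {ι : Type*}

/-- The kernels of a family of sections with pairwise distinct closed points are pairwise comaximal. [cite: StacksProject, Tag 00DT] -/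
theorem pairwise_isCoprime_ker (s : ι → (B →ₐ[R] R)) (h : Pairwise fun i j => (maximalIdeal R).comap (s i) ≠ (maximalIdeal R).comap (s j)) :
    Pairwise (Function.onFun IsCoprime fun i => RingHom.ker (s i)) :=
  fun _ _ hij => isCoprime_ker_of_comap_maximalIdeal_ne (h hij)

omit [IsLocalRing R] in
/-- **THE KERNEL OF THE EVALUATION MAP** `b ↦ (sᵢ b)ᵢ` is `⨅ᵢ ker sᵢ`. [cite: StacksProject, Tag 00DT] -/
theorem ker_pi_eq_iInf (s : ι → (B →ₐ[R] R)) : RingHom.ker (AlgHom.pi s : B →ₐ[R] (ι → R)) = ⨅ i, RingHom.ker (s i) := by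
  ext b
  simp only [RingHom.mem_ker, _root_.Ideal.mem_iInf]
  constructor
  · intro h i
    have := congr_fun h i
    rwa [AlgHom.pi_apply] at this
  · intro h
    funext i
    rw [AlgHom.pi_apply]
    exact h i

variable [Finite ι]

/-- **CHINESE REMAINDER FOR SECTIONS WITH DISTINCT CLOSED POINTS**: for a finite family `s : ι → (B →ₐ[R] R)` over a LOCAL ring with pairwise distinct closed
points `sᵢ⁻¹(𝔪_R)`, the evaluation map `B → R^ι`, `b ↦ (sᵢ b)ᵢ`, is SURJECTIVE (its kernel is `⨅ ker sᵢ`, `ker_pi_eq_iInf`); so `B ⧸ ⨅ ker sᵢ ≅ R^ι` is free of rank `|ι|`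
and a product of copies of the base. [cite: StacksProject, Tag 00DT] [cite: StacksProject, Tag 04GG] [cite: Tate1997FiniteFlatGroupSchemes, (3.7)] -/
theorem surjective_pi_of_pairwise_comap_maximalIdeal_ne (s : ι → (B →ₐ[R] R))
    (h : Pairwise fun i j => (maximalIdeal R).comap (s i) ≠ (maximalIdeal R).comap (s j)) :
    Function.Surjective (AlgHom.pi s : B →ₐ[R] (ι → R)) := by
  classical
  intro g
  obtain ⟨x, hx⟩ := _root_.Ideal.quotientInfToPiQuotient_surj (pairwise_isCoprime_ker s h)
    (fun i => _root_.Ideal.Quotient.mk (RingHom.ker (s i)) (algebraMap R B (g i)))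
  obtain ⟨b, rfl⟩ := _root_.Ideal.Quotient.mk_surjective x
  refine ⟨b, funext fun i => ?_⟩
  have hi := congr_fun hx i
  rw [_root_.Ideal.quotientInfToPiQuotient_mk', _root_.Ideal.Quotient.eq, RingHom.mem_ker, map_sub, AlgHom.commutes, sub_eq_zero] at hi
  rw [AlgHom.pi_apply, hi, Algebra.algebraMap_self, RingHom.id_apply]

/-- The evaluation map induces an `R`-ALGEBRA ISOMORPHISM `B ⧸ ker ≃ₐ[R] R^ι` (Mathlib `Ideal.quotientKerAlgEquivOfSurjective`); recorded as the existence of an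
algebra equivalence from the quotient by `⨅ ker sᵢ`. [cite: StacksProject, Tag 00DT] -/
theorem nonempty_quotient_iInf_ker_algEquiv_pi (s : ι → (B →ₐ[R] R))
    (h : Pairwise fun i j => (maximalIdeal R).comap (s i) ≠ (maximalIdeal R).comap (s j)) :
    Nonempty ((B ⧸ ⨅ i, RingHom.ker (s i)) ≃ₐ[R] (ι → R)) := by
  rw [← ker_pi_eq_iInf]
  exact ⟨_root_.Ideal.quotientKerAlgEquivOfSurjective (surjective_pi_of_pairwise_comap_maximalIdeal_ne s h)⟩

end Family

/-! ## §4 Same closed point ⇔ same reduction -/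

section Residue

variable {R : Type*} [CommRing R] [IsLocalRing R] {B : Type*} [CommRing B] [Algebra R B]

/-- Pointwise form of `residue (s₁ b) = residue (s₂ b) ↔ s₁ b − s₂ b ∈ 𝔪_R` used above (Mathlib `Ideal.Quotient.mk_eq_mk_iff_sub_mem`). [cite: StacksProject, Tag 04GG] -/
theorem residue_eq_residue_iff_sub_mem (x y : R) : residue R x = residue R y ↔ x - y ∈ maximalIdeal R :=
  _root_.Ideal.Quotient.mk_eq_mk_iff_sub_mem x y

/-- Two sections with the SAME closed point agree modulo `𝔪_R`: `s₁ b − s₂ b ∈ 𝔪_R` for every `b` (`b − s₁(b)·1 ∈ ker s₁ ⊆ s₁⁻¹(𝔪_R) = s₂⁻¹(𝔪_R)`).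
[cite: StacksProject, Tag 04GG] -/
theorem sub_mem_maximalIdeal_of_comap_maximalIdeal_eq {s₁ s₂ : B →ₐ[R] R} (h : (maximalIdeal R).comap s₁ = (maximalIdeal R).comap s₂) (b : B) :
    s₁ b - s₂ b ∈ maximalIdeal R := by
  have h1 : b - algebraMap R B (s₁ b) ∈ (maximalIdeal R).comap s₂ := by
    rw [← h, _root_.Ideal.mem_comap, map_sub, AlgHom.commutes, Algebra.algebraMap_self, RingHom.id_apply, sub_self]
    exact zero_mem _
  rw [_root_.Ideal.mem_comap, map_sub, AlgHom.commutes, Algebra.algebraMap_self, RingHom.id_apply] at h1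
  rw [← neg_sub]
  exact neg_mem h1

/-- **SAME CLOSED POINT ⇔ SAME REDUCTION**: two sections `s₁ s₂ : B →ₐ[R] R` over a local ring have the same closed point `sᵢ⁻¹(𝔪_R)` iff their
reductions `B → κ(R)` agree. [cite: StacksProject, Tag 04GG] -/
theorem comap_maximalIdeal_eq_iff_residue_eq (s₁ s₂ : B →ₐ[R] R) :
    (maximalIdeal R).comap s₁ = (maximalIdeal R).comap s₂ ↔ ∀ b, residue R (s₁ b) = residue R (s₂ b) := by
  constructor
  · intro h b
    exact (residue_eq_residue_iff_sub_mem (s₁ b) (s₂ b)).2 (sub_mem_maximalIdeal_of_comap_maximalIdeal_eq h b)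
  · intro h
    ext b
    rw [_root_.Ideal.mem_comap, _root_.Ideal.mem_comap, ← residue_eq_zero_iff, ← residue_eq_zero_iff, h b]

end Residue

end Literature.RingTheory.Ideal
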